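import Summits.ResolutionOfSingularities.ResolutionOfSingularities.Theorems.FrobeniusClosingPatchingRelPerfectDepthPhaseCReachNDom
import Summits.ResolutionOfSingularities.ResolutionOfSingularities.Theorems.FrobeniusClosingPatchingRelPerfectDepthTraceEquimultipleHost
import Summits.ResolutionOfSingularities.ResolutionOfSingularities.Theorems.FrobeniusClosingPatchingRelPerfectDepthPhaseCReachMemberHitOfNDom
import HarnessLib

/-!
# Crux `PatchingRelPerfect` (stmt-ResolutionOfSingularities-16161), chain W5.2 — F7(β) (β-AX) X3 C-I (M0) part 2, closed form:
# `NDominates` HOLDS ON EVERY REACHABLE CYLINDER STATE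

[OURS · L1 W5.2 · res-L1-w52-plan-1 RULING G12-23 (1) (hand res-L1-w52-lead-1 g6).]  Replaces the role of NO printed item; NOT a statement
of the manuscript under review (AI-written; AI review weaker than expert review; counted 0).  Def-free.

The open-form step `nDominates_step` (…DepthPhaseCReachNDom) closed over the v7 `StepStable` binders: its one extra hypothesis, the X-side
equimultiplicity `hequiX : ∀ i, ∀ y ∈ cyl.centre C, idealOrder (S.host i) y = m i`, is res-L1-w52-stub-1΄s (EQ-glue) export
`CylState.hequiX_of_binders` (…DepthTraceEquimultipleHost), fed with the regularity of `X` (`CylReach.isRegular`) and of the cylinder `cyl.Z`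
(carried along: `AtlasInitial` binder; step `IsBlowup.isRegular_of_isRegular_subscheme` along `τZ`).

* `atlasInitial_regular_nDominates` / `stepStable_regular_nDominates` — the conjunction «`X` regular ∧ `cyl.Z` regular ∧ `NDominates S cyl`»
  is initially valid and step-stable;
* `CylReach.nDominates` — **N-domination on every reachable cylinder state** (the (M0) bookkeeping clause of record; its pointwise corollaries —
  member hit off the carrier, LEMMA V, swallowing — are res-L1-w52-stub-2΄s `…DepthPhaseCReachMemberHitOfNDom`);
* `CylReach.memberHitOffZ` / `CylReach.memberHit` — **(M0) THE MEMBER-HIT CLAUSE ON EVERY REACHABLE CYLINDER STATE** (off the carrier, resp.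
  off the cylinder region; stub-2΄s `memberHitOffZ_of_nDominates` p566396 on `CylReach.nDominates`).

## References
* J. Kollár, *Lectures on Resolution of Singularities* (2007), (3.111) Steps 1–3. [Kollar2007]
* V. Cossart, U. Jannsen, S. Saito, arXiv:0905.2191v2 (2020), Thm. 3.3. [CossartJannsenSaito2020]
-/

-- `Summit.<Summit>.<Sub>.Theorems` with `Sub = Summit` (single-conjunct summit, D-0017)
set_option linter.dupNamespace false

noncomputable section

open CategoryTheory AlgebraicGeometry TopologicalSpace IsLocalRing
open Literature.AlgebraicGeometry.Resolution Scheme.IdealSheafData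

namespace Summit.ResolutionOfSingularities.ResolutionOfSingularities.Theorems.ChainW52F7BetaRP

universe u

open DepthMultiHost

/-- [OURS · L1 W5.2] Generation 1: `X` regular, the cylinder regular, and `NDominates`. [folklore] -/
theorem atlasInitial_regular_nDominates :
    AtlasInitial (fun X S cyl => Scheme.IsRegular X ∧ Scheme.IsRegular cyl.Z ∧ NDominates S cyl) :=
  fun _ _ St cyl _ _ hV hZreg hZexc hZdim h𝓔 hXexc hn hshape =>
    ⟨atlasInitial_isRegular St cyl hV hZreg hZexc hZdim h𝓔 hXexc hn hshape, hZreg,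
      atlasInitial_nDominates St cyl hV hZreg hZexc hZdim h𝓔 hXexc hn hshape⟩

/-- [OURS · L1 W5.2] **The closed step**: under the v7 cylinder step, «`X` regular ∧ `cyl.Z` regular ∧ `NDominates`» persists — `nDominates_step`
with `hequiX` supplied by `CylState.hequiX_of_binders` (res-L1-w52-stub-1). [cite: Kollar2007, (3.111) Steps 1–3]
[cite: CossartJannsenSaito2020, Thm. 3.3] -/
theorem stepStable_regular_nDominates :
    StepStable (fun X S cyl => Scheme.IsRegular X ∧ Scheme.IsRegular cyl.Z ∧ NDominates S cyl) := by
  intro X X' _ _ S cyl _ _ C hC0 hCreg hCrad 𝓑 h𝓑 h𝓑C D hD hsub hBsing hperm τ hτ η hη m hm hm' hsncX cyl' τZ hτZ hsq hker htr hbd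
    hbdF hV' hlow h
  obtain ⟨hX, hZ, hN⟩ := h
  refine ⟨hτ.isRegular_of_isRegular_subscheme hX hsncX.isRegular_subscheme, hτZ.isRegular_of_isRegular_subscheme hZ hCreg, ?_⟩
  exact nDominates_step hX S cyl C τ hτ η hη m hm
    (cyl.hequiX_of_binders (fun y _ => hX y) hZ C hCreg D hD hsub hperm hη m hm hm') hsncX cyl' hker hN

/-- [OURS · L1 W5.2 · X3 C-I (M0)] **N-DOMINATION ON EVERY REACHABLE CYLINDER STATE.** [cite: Kollar2007, (3.111) Steps 1–3] -/
theorem CylReach.nDominates {X : Scheme.{u}} {S : MultiHostState X} {cyl : CylState S} (h : CylReach S cyl) : NDominates S cyl :=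
  (cylReach_le stepStable_regular_nDominates atlasInitial_regular_nDominates S cyl h).2.2

/-- [OURS · L1 W5.2 · X3 C-I (M0)] **THE MEMBER HIT OFF THE CARRIER on every reachable cylinder state** (= LEMMA V on `cyl.V ∖ j(Z)` and the
(M0) clause off `cyl.V` at once): at a carrier-free point of the residual cosupport off `range cyl.j`, the residual stalk lies in the ideal
generated by the members through the point. [cite: Kollar2007, (3.111) Step 3] -/
theorem CylReach.memberHitOffZ {X : Scheme.{u}} [IsLocallyNoetherian X] {S : MultiHostState X} {cyl : CylState S} (h : CylReach S cyl) :
    ∀ x ∈ (S.residual.K.support : Set X), x ∉ Set.range cyl.j.base →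
      (¬ ∃ v ∈ stalkIdeal S.residual.K x, v ∉ (maximalIdeal (X.presheaf.stalk x)) ^ 2) →
      stalkIdeal S.residual.K x ≤ ⨆ (T : X.IdealSheafData) (_ : T ∈ S.𝓔 ∧ x ∈ (T.support : Set X)), stalkIdeal T x :=
  S.memberHitOffZ_of_nDominates cyl h.nDominates

/-- [OURS · L1 W5.2 · X3 C-I (M0)] **THE (M0) MEMBER-HIT CLAUSE OF RECORD** (res-L1-w52-stub-2 `…DepthPhaseCReachMemberHit`, binder
`x ∉ cyl.V`) **holds on every reachable cylinder state** (`range cyl.j ⊆ cyl.V`). [cite: Kollar2007, (3.111) Step 3] -/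
theorem CylReach.memberHit {X : Scheme.{u}} [IsLocallyNoetherian X] {S : MultiHostState X} {cyl : CylState S} (h : CylReach S cyl) :
    ∀ x ∈ (S.residual.K.support : Set X), x ∉ (cyl.V : Set X) →
      (¬ ∃ v ∈ stalkIdeal S.residual.K x, v ∉ (maximalIdeal (X.presheaf.stalk x)) ^ 2) →
      stalkIdeal S.residual.K x ≤ ⨆ (T : X.IdealSheafData) (_ : T ∈ S.𝓔 ∧ x ∈ (T.support : Set X)), stalkIdeal T x :=
  fun x hx hxV => h.memberHitOffZ x hx fun hxj => hxV (cyl.range_j_subset hxj)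

end Summit.ResolutionOfSingularities.ResolutionOfSingularities.Theorems.ChainW52F7BetaRP

end
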